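import Summits.QuantumFields.BalabanUV.Beta.D1BFx.FineHessianWardRelative
import Summits.QuantumFields.BalabanUV.Beta.FP.RepSeam

/-!
# `BalabanUV.Beta.FP.PerfectFineWard` — road «FP» for binder row D1, row N3-fine REDUCED TO LETTERS: the `hrow` binder of
# `FP/RepSeam.hrep_perfect_of_rows` ∕ `FP/PerfectFullSandwich.secondMoment_TPerfOf_perfect_eq` (and the first-bond transversality
# behind leaf-02's Kronecker–Ward route to `hT1`) at the dressed leg `Π K Π = axDressK n K` and at the perfect resolvent
# `KPerf Lc (sfStep Lc) (smStep 3 Lc) m`, `n = Lc^m`, from three letters of an1's shapes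

HONEST DEPENDENCY (page 1, mandatory): continuum YM on T⁴ ⇐ BetaPertH ∧ nine spine estimates (0/9 proved); BetaPertH ⇐ (D1) ∧ (D4) ∧
CAP+tail; G-an2-4 gates asym, D1 and NE2/3/4.  HONEST FRAMING (cell contract, verbatim): «discharging `BetaPertH` makes Bałaban's UV
stability UNCONDITIONAL — a real constructive-QFT result; it is NOT the continuum limit and NOT the Clay problem.»  A REDUCTION, NOT A
DISCHARGE: the three letters at the perfect family — (K) the relative-inverse structure `RelInv (Π K_perf Π) 𝕄 E`, (S) the block-stencil
Ward law `cH • Σ_{v∈box} divV S (n•y + v) = conjV 𝕄 (Xc y)`, (W) the second-order law (W2♮) of `Wf` against the base-point-supported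
generator with a tadpole-null remainder — are HYPOTHESES (K-side: N0b ∕ X1 words; S∕W-side: the jet-level Ward identities of the wall
family — an1's `hSd`, leaf-10's `WardLocusRecursive.hSd_SrecAt` at every finite `j` — and their inheritance to the perfect limit,
N3(ii)–(iv)); whether road FP's perfect stencil ∕ table satisfy them is NOT asserted.  No definition, no `def … : Prop`, nothing cited;
0∕4 binders of row D1; NOT `hrow` at the perfect letters, NOT `hrep`, NOT D1, NOT BetaPertH, NOT continuum, NOT Clay.
ABSOLUTE RULE (cell charter, verbatim): «No internally-minted statement may enter as a cited fact. Every hypothesis is either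
kernel-proved in this package or a verbatim quotation of a PUBLISHED theorem with page reference. The manuscript(s) under audit are NOT
citable for their own disputed steps — they are the thing under adjudication; programme-internal (2001/route/tribunal) claims are never
citable.»

CONTENT (all [folklore]; `d + 1 = 4`, packed fibre `Fib 3`).
* §1 any decaying `K`, `1 ≤ n`: **`divFree_fineHessA_axDressK_of_letters`**, **`hrow_axDressK_of_letters`** (`Spr (axDressK n K)` by
  `AxialDressing.decays_axDressK`; `D1BFx/FineHessianWardRelative` §3 BY NAME).
* §2 the perfect resolvent (`2 ≤ Lc`, `1 ≤ m`; decay by `StepLawKHolds.exists_decays_KPerf_holds`): **`divFree_fineHessA_perfect_of_letters`**,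
  **`hrow_perfect_of_letters`** — conclusion token for token the `hrow` binder of `RepSeam.hrep_perfect_of_rows` — and the KERNEL-CHECKED
  SOCKET FIT **`hrep_perfect_of_letters`** = `RepSeam.hrep_perfect_of_rows` with `hrow` replaced by the letters (every other hypothesis
  verbatim: coarse covariance, symmetry, `hT1`, LEGS `hlegs`, TAILS `htail`).
Claim table `HOME/b2b-balaban-beta-d1-p3/LEAVES-FP.md` sub-row N3-fine-REL.  Unit `b2b-balaban-beta-d1-formalise-leaf-01` (gen 5), 2026-08-20.
-/

noncomputable section

open Finset Filter Topology
open scoped BigOperators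

namespace Summit.QuantumFields.BalabanUV.Beta.FP.PerfectFineWard

open Literature.Probability.LatticeModels (annulus)
open Literature.MathematicalPhysics.QuantumFieldTheory.Balaban1983to89
open Literature.MathematicalPhysics.QuantumFieldTheory.Balaban1983to89.Beta
open ExpKernelCalculus (Site MKer Decays BiLoc comp tadpole shiftK)
open AffineAveraging (box toSite)
open AveragingContours (blk)
open KernelWard (divV divW)
open B6BondElimination (unitVec)
open DressedMomentNormalisation (resSite)
open WindowIdentification (psum fullSum)
open DyadicShell (Pt toReal)
open OneStepResolventKernel (Fib LocStencil)
open AxialProjector (coProj)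
open AxialDressing (axDressK decays_axDressK)
open SecondOrderResponse (vertex2OfK)
open Summit.QuantumFields.BalabanUV.Beta.TameKernelCalculus
open Summit.QuantumFields.BalabanUV.Beta.ChartConjugation (conjV conjW)
open Summit.QuantumFields.BalabanUV.Beta.ChartConjugationRelative (RelInv)
open Summit.QuantumFields.BalabanUV.Beta.GAN24.CombesThomas (sfStep smStep)
open Summit.QuantumFields.BalabanUV.Beta.D1BFx.MomentTransferPeriodic (baseKer)
open Summit.QuantumFields.BalabanUV.Beta.D1BFx.ReducedKernelSandwichLeg (fineHessA)
open Summit.QuantumFields.BalabanUV.Beta.D1BFx.FineHessianWardRelative (divFree_fineHessA_coProj_of_letters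
  hasSum_row_fineHessA_coProj_of_letters)
open Summit.QuantumFields.BalabanUV.Beta.FP.PerfectObjectsT (KPerf TPerfOf)
open Summit.QuantumFields.BalabanUV.Beta.FP.StepLawKHolds (exists_decays_KPerf_holds)
open Summit.QuantumFields.BalabanUV.Beta.FP.RepSeam (hrep_perfect_of_rows)

/-! ## §1 Any decaying resolvent `K`, dressed leg `Π K Π = axDressK n K` -/

section Dressed

variable {n : ℕ} {K M E : MKer (3 + 1) (Fib 3)} {C δ : ℝ}
  {S : Fin (3 + 1) → (Fin (3 + 1) → ℤ) → MKer (3 + 1) (Fib 3)} {Cs δs : ℝ}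
  {Wf : Fin (3 + 1) → (Fin (3 + 1) → ℤ) → Fin (3 + 1) → (Fin (3 + 1) → ℤ) → MKer (3 + 1) (Fib 3)} {C2 δ2 : ℝ}
  {Xc : (Fin (3 + 1) → ℤ) → MKer (3 + 1) (Fib 3)} {cH : ℝ}
  {X₂ Nr : (Fin (3 + 1) → ℤ) → Fin (3 + 1) → (Fin (3 + 1) → ℤ) → MKer (3 + 1) (Fib 3)}

/-- [folklore] **FIRST-BOND TRANSVERSALITY OF THE DRESSED FINE HESSIAN KERNEL `fineHessA (Π K Π) (Πᵀ S) Wf` FROM LETTERS** — any decaying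
resolvent `K` (`1 ≤ n`): the relative-inverse letter `RelInv (axDressK n K) 𝕄 E`, the block-stencil Ward letter of `S`, the second-order
letter (W2♮) of `Wf` against the base-point-supported generator (see `D1BFx/FineHessianWardRelative.divFree_fineHessA_coProj_of_letters`; the dressed stencil's pure-gauge vertex is `D1BFx/CoProjDivergence.divV_coProj`). -/
theorem divFree_fineHessA_axDressK_of_letters (hn : 1 ≤ n) (hK : Decays K C δ) (hδ : 0 < δ) (hM : Spr M) (hE : Spr E)
    (hR : RelInv (axDressK n K) M E)
    (hS : LocStencil S Cs δs) (hδs : 0 < δs) (hW : ∀ κ' u l' u', BiLoc (Wf κ' u l' u') u u' C2 δ2) (hδ2 : 0 < δ2)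
    (hcH : cH ≠ 0) (hXc : ∀ y, Loc (Xc y)) (hEXc : ∀ y, comp E (Xc y) = comp (Xc y) E)
    (hSd : ∀ y : Fin (3 + 1) → ℤ, cH • ∑ v ∈ box (3 + 1) n, divV S ((n : ℤ) • y + toSite v) = conjV M (Xc y))
    (hX₂ : ∀ u ν u', Loc (X₂ u ν u')) (hEX₂ : ∀ u ν u', comp E (X₂ u ν u') = comp (X₂ u ν u') E)
    (hNr : ∀ u ν u', Loc (Nr u ν u')) (hN0 : ∀ u ν u', tadpole (axDressK n K) (Nr u ν u') = 0)
    (hWd : ∀ u ν u', divW Wf u ν u' = conjW M 0 (coProj n S ν u')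
      (if (n : ℤ) • blk n u = u then cH⁻¹ • Xc (blk n u) else 0) 0 (X₂ u ν u') + Nr u ν u')
    (l' : Fin (3 + 1)) (u' u : Fin (3 + 1) → ℤ) :
    ∑ κ' : Fin (3 + 1), (fineHessA (axDressK n K) (coProj n S) Wf κ' l' (u - unitVec κ') u'
      - fineHessA (axDressK n K) (coProj n S) Wf κ' l' u u') = 0 :=
  divFree_fineHessA_coProj_of_letters hn ⟨_, δ, hδ, decays_axDressK hn hK hδ.le⟩ hM hE hR hS hδs hW hδ2 hcH hXc hEXc hSd hX₂ hEX₂ hNr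
    hN0 hWd l' u' u

/-- [folklore] **THE WARD ROWS `hrow` OF THE DRESSED FINE HESSIAN KERNEL FROM LETTERS** — any decaying resolvent `K`, symmetric `Wf`: the
`hrow` binder of `FP/PerfectFullSandwich.bondSecondMoment_TPerfOf_eq_avgM2` ∕ `secondMoment_TPerfOf_vertex2OfK_eq`, token for token. -/
theorem hrow_axDressK_of_letters (hn : 1 ≤ n) (hK : Decays K C δ) (hδ : 0 < δ) (hM : Spr M) (hE : Spr E)
    (hR : RelInv (axDressK n K) M E)
    (hS : LocStencil S Cs δs) (hδs : 0 < δs) (hW : ∀ κ' u l' u', BiLoc (Wf κ' u l' u') u u' C2 δ2) (hδ2 : 0 < δ2)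
    (hWsymm : ∀ (κ' : Fin 4) (u : Site 4) (l' : Fin 4) (u' : Site 4), Wf κ' u l' u' = Wf l' u' κ' u)
    (hcH : cH ≠ 0) (hXc : ∀ y, Loc (Xc y)) (hEXc : ∀ y, comp E (Xc y) = comp (Xc y) E)
    (hSd : ∀ y : Fin (3 + 1) → ℤ, cH • ∑ v ∈ box (3 + 1) n, divV S ((n : ℤ) • y + toSite v) = conjV M (Xc y))
    (hX₂ : ∀ u ν u', Loc (X₂ u ν u')) (hEX₂ : ∀ u ν u', comp E (X₂ u ν u') = comp (X₂ u ν u') E)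
    (hNr : ∀ u ν u', Loc (Nr u ν u')) (hN0 : ∀ u ν u', tadpole (axDressK n K) (Nr u ν u') = 0)
    (hWd : ∀ u ν u', divW Wf u ν u' = conjW M 0 (coProj n S ν u')
      (if (n : ℤ) • blk n u = u then cH⁻¹ • Xc (blk n u) else 0) 0 (X₂ u ν u') + Nr u ν u') :
    ∀ (κ' l' : Fin 4) (b : Site 4), HasSum (fineHessA (axDressK n K) (coProj n S) Wf κ' l' b) 0 :=
  fun κ' l' b => hasSum_row_fineHessA_coProj_of_letters hn ⟨_, δ, hδ, decays_axDressK hn hK hδ.le⟩ hM hE hR hS hδs hW hδ2 hWsymm hcH hXc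
    hEXc hSd hX₂ hEX₂ hNr hN0 hWd κ' l' b

end Dressed

/-! ## §2 At the perfect resolvent `KPerf Lc (sfStep Lc) (smStep 3 Lc) m`, blocking `n = Lc^m` -/

section Perfect

variable {Lc : ℕ} [NeZero Lc] {m : ℕ} {M E : MKer (3 + 1) (Fib 3)}
  {S : Fin (3 + 1) → (Fin (3 + 1) → ℤ) → MKer (3 + 1) (Fib 3)} {Cs δs : ℝ}
  {Wf : Fin (3 + 1) → (Fin (3 + 1) → ℤ) → Fin (3 + 1) → (Fin (3 + 1) → ℤ) → MKer (3 + 1) (Fib 3)} {C2 δ2 : ℝ}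
  {Xc : (Fin (3 + 1) → ℤ) → MKer (3 + 1) (Fib 3)} {cH : ℝ}
  {X₂ Nr : (Fin (3 + 1) → ℤ) → Fin (3 + 1) → (Fin (3 + 1) → ℤ) → MKer (3 + 1) (Fib 3)}

/-- [folklore] **FIRST-BOND TRANSVERSALITY OF THE PERFECT DRESSED FINE KERNEL FROM LETTERS** (`2 ≤ Lc`, `1 ≤ m`; decay of the perfect
resolvent by `StepLawKHolds.exists_decays_KPerf_holds`): the divergence-freeness input of leaf-02's Kronecker-Ward route to `hT1` and of
`hrow`, for `fineHessA (axDressK (Lc^m) (KPerf … m)) (coProj (Lc^m) S) Wf`, reduced to the three perfect-family letters. -/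
theorem divFree_fineHessA_perfect_of_letters (hLc : 2 ≤ Lc) (hm : 1 ≤ m) (hM : Spr M) (hE : Spr E)
    (hR : RelInv (axDressK (Lc ^ m) (KPerf (d := 3) Lc (sfStep Lc) (smStep 3 Lc) m)) M E)
    (hS : LocStencil S Cs δs) (hδs : 0 < δs) (hW : ∀ κ' u l' u', BiLoc (Wf κ' u l' u') u u' C2 δ2) (hδ2 : 0 < δ2)
    (hcH : cH ≠ 0) (hXc : ∀ y, Loc (Xc y)) (hEXc : ∀ y, comp E (Xc y) = comp (Xc y) E)
    (hSd : ∀ y : Fin (3 + 1) → ℤ, cH • ∑ v ∈ box (3 + 1) (Lc ^ m), divV S (((Lc ^ m : ℕ) : ℤ) • y + toSite v) = conjV M (Xc y))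
    (hX₂ : ∀ u ν u', Loc (X₂ u ν u')) (hEX₂ : ∀ u ν u', comp E (X₂ u ν u') = comp (X₂ u ν u') E)
    (hNr : ∀ u ν u', Loc (Nr u ν u'))
    (hN0 : ∀ u ν u', tadpole (axDressK (Lc ^ m) (KPerf (d := 3) Lc (sfStep Lc) (smStep 3 Lc) m)) (Nr u ν u') = 0)
    (hWd : ∀ u ν u', divW Wf u ν u' = conjW M 0 (coProj (Lc ^ m) S ν u')
      (if ((Lc ^ m : ℕ) : ℤ) • blk (Lc ^ m) u = u then cH⁻¹ • Xc (blk (Lc ^ m) u) else 0) 0 (X₂ u ν u') + Nr u ν u')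
    (l' : Fin (3 + 1)) (u' u : Fin (3 + 1) → ℤ) :
    ∑ κ' : Fin (3 + 1), (fineHessA (axDressK (Lc ^ m) (KPerf (d := 3) Lc (sfStep Lc) (smStep 3 Lc) m)) (coProj (Lc ^ m) S) Wf κ' l'
        (u - unitVec κ') u'
      - fineHessA (axDressK (Lc ^ m) (KPerf (d := 3) Lc (sfStep Lc) (smStep 3 Lc) m)) (coProj (Lc ^ m) S) Wf κ' l' u u') = 0 := by
  have hn : 1 ≤ Lc ^ m := Nat.one_le_pow _ _ (by omega)
  obtain ⟨CK, δK, hδK, hK⟩ := exists_decays_KPerf_holds hLc hm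
  exact divFree_fineHessA_axDressK_of_letters hn hK hδK hM hE hR hS hδs hW hδ2 hcH hXc hEXc (by exact_mod_cast hSd) hX₂ hEX₂ hNr hN0
    (by exact_mod_cast hWd) l' u' u

/-- [folklore] **N3-fine REDUCED TO LETTERS: THE `hrow` BINDER OF `FP/RepSeam.hrep_perfect_of_rows` ∕
`FP/PerfectFullSandwich.secondMoment_TPerfOf_perfect_eq` ∕ `FP/PerfectRepBasePoint.secondMoment_TPerfOf_perfect_eq_basePoint`**, token for
token, from the three perfect-family letters (relative-inverse structure of `Π K_perf Π`; block-stencil Ward law of `S`; (W2♮) of `Wf`). -/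
theorem hrow_perfect_of_letters (hLc : 2 ≤ Lc) (hm : 1 ≤ m) (hM : Spr M) (hE : Spr E)
    (hR : RelInv (axDressK (Lc ^ m) (KPerf (d := 3) Lc (sfStep Lc) (smStep 3 Lc) m)) M E)
    (hS : LocStencil S Cs δs) (hδs : 0 < δs) (hW : ∀ κ' u l' u', BiLoc (Wf κ' u l' u') u u' C2 δ2) (hδ2 : 0 < δ2)
    (hWsymm : ∀ (κ' : Fin 4) (u : Site 4) (l' : Fin 4) (u' : Site 4), Wf κ' u l' u' = Wf l' u' κ' u)
    (hcH : cH ≠ 0) (hXc : ∀ y, Loc (Xc y)) (hEXc : ∀ y, comp E (Xc y) = comp (Xc y) E)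
    (hSd : ∀ y : Fin (3 + 1) → ℤ, cH • ∑ v ∈ box (3 + 1) (Lc ^ m), divV S (((Lc ^ m : ℕ) : ℤ) • y + toSite v) = conjV M (Xc y))
    (hX₂ : ∀ u ν u', Loc (X₂ u ν u')) (hEX₂ : ∀ u ν u', comp E (X₂ u ν u') = comp (X₂ u ν u') E)
    (hNr : ∀ u ν u', Loc (Nr u ν u'))
    (hN0 : ∀ u ν u', tadpole (axDressK (Lc ^ m) (KPerf (d := 3) Lc (sfStep Lc) (smStep 3 Lc) m)) (Nr u ν u') = 0)
    (hWd : ∀ u ν u', divW Wf u ν u' = conjW M 0 (coProj (Lc ^ m) S ν u')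
      (if ((Lc ^ m : ℕ) : ℤ) • blk (Lc ^ m) u = u then cH⁻¹ • Xc (blk (Lc ^ m) u) else 0) 0 (X₂ u ν u') + Nr u ν u') :
    ∀ (κ' l' : Fin 4) (b : Site 4),
      HasSum (fineHessA (axDressK (Lc ^ m) (KPerf (d := 3) Lc (sfStep Lc) (smStep 3 Lc) m)) (coProj (Lc ^ m) S) Wf κ' l' b) 0 := by
  have hn : 1 ≤ Lc ^ m := Nat.one_le_pow _ _ (by omega)
  obtain ⟨CK, δK, hδK, hK⟩ := exists_decays_KPerf_holds hLc hm
  exact hrow_axDressK_of_letters hn hK hδK hM hE hR hS hδs hW hδ2 hWsymm hcH hXc hEXc (by exact_mod_cast hSd) hX₂ hEX₂ hNr hN0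
    (by exact_mod_cast hWd)

/-- [folklore] **SOCKET FIT, KERNEL-CHECKED: `FP/RepSeam.hrep_perfect_of_rows` WITH `hrow` DISCHARGED FROM THE LETTERS** — the seam's
other hypotheses verbatim (`hT1`, LEGS `hlegs`, TAILS `htail`), `hrow` replaced by the three letters; conclusion = the `hrep` shape of
`AsymptoticEndAvg.hasym_of_legInterface_avg` at blocking `n = Lc^m`. -/
theorem hrep_perfect_of_letters (hLc : 2 ≤ Lc) (hm : 1 ≤ m) (hM : Spr M) (hE : Spr E)
    (hR : RelInv (axDressK (Lc ^ m) (KPerf (d := 3) Lc (sfStep Lc) (smStep 3 Lc) m)) M E)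
    (hS : LocStencil S Cs δs) (hδs : 0 < δs)
    (hScov : ∀ κ u t, S κ (u + ((Lc ^ m : ℕ) : ℤ) • t) = shiftK (-(((Lc ^ m : ℕ) : ℤ) • t)) (S κ u))
    (hW : ∀ κ' u l' u', BiLoc (Wf κ' u l' u') u u' C2 δ2) (hδ2 : 0 < δ2)
    (hWcov : ∀ κ' u l' u' t, Wf κ' (u + ((Lc ^ m : ℕ) : ℤ) • t) l' (u' + ((Lc ^ m : ℕ) : ℤ) • t)
      = shiftK (-(((Lc ^ m : ℕ) : ℤ) • t)) (Wf κ' u l' u'))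
    (hWsymm : ∀ (κ' : Fin 4) (u : Site 4) (l' : Fin 4) (u' : Site 4), Wf κ' u l' u' = Wf l' u' κ' u)
    (hcH : cH ≠ 0) (hXc : ∀ y, Loc (Xc y)) (hEXc : ∀ y, comp E (Xc y) = comp (Xc y) E)
    (hSd : ∀ y : Fin (3 + 1) → ℤ, cH • ∑ v ∈ box (3 + 1) (Lc ^ m), divV S (((Lc ^ m : ℕ) : ℤ) • y + toSite v) = conjV M (Xc y))
    (hX₂ : ∀ u ν u', Loc (X₂ u ν u')) (hEX₂ : ∀ u ν u', comp E (X₂ u ν u') = comp (X₂ u ν u') E)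
    (hNr : ∀ u ν u', Loc (Nr u ν u'))
    (hN0 : ∀ u ν u', tadpole (axDressK (Lc ^ m) (KPerf (d := 3) Lc (sfStep Lc) (smStep 3 Lc) m)) (Nr u ν u') = 0)
    (hWd : ∀ u ν u', divW Wf u ν u' = conjW M 0 (coProj (Lc ^ m) S ν u')
      (if ((Lc ^ m : ℕ) : ℤ) • blk (Lc ^ m) u = u then cH⁻¹ • Xc (blk (Lc ^ m) u) else 0) 0 (X₂ u ν u') + Nr u ν u')
    (hT1 : ∀ (κ' l' μ' : Fin 4), ∑ r : Fin 4 → Fin (Lc ^ m), ∑' t, (t μ' : ℝ) *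
      baseKer (fineHessA (axDressK (Lc ^ m) (KPerf (d := 3) Lc (sfStep Lc) (smStep 3 Lc) m)) (coProj (Lc ^ m) S) Wf κ' l')
        (resSite r) t = 0)
    (μ ν : Fin 4)
    {ι : Type*} {s : Finset ι} {cc₀ : ι → ℝ} {F' G' : (Fin 4 → ℤ) → ι → Pt → ℝ} {R₀ Mw : ℕ} (hMR : Mw ≤ R₀)
    {U₁ Et δ Lr : ℝ} (hEt : 0 ≤ Et) (hδ : 0 < δ) (hL : 0 < Lr)
    (hlegs : ∀ b ∈ (univ : Finset (Fin 4 → Fin (Lc ^ m))).image resSite,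
      |psum (fun w : Pt => ((((Lc ^ m : ℕ) : ℝ)) ^ 8)⁻¹ * (toReal w μ * toReal w ν *
          baseKer (fineHessA (axDressK (Lc ^ m) (KPerf (d := 3) Lc (sfStep Lc) (smStep 3 Lc) m)) (coProj (Lc ^ m) S) Wf μ ν) b w)) R₀
        - ∑ w ∈ annulus 4 0 R₀, toReal w μ * toReal w ν * ∑ i ∈ s, cc₀ i * (F' b i w * G' b i w)| ≤ U₁)
    (htail : ∀ b ∈ (univ : Finset (Fin 4 → Fin (Lc ^ m))).image resSite, ∀ r : ℕ, Mw ≤ r → ∀ w ∈ annulus 4 r (r + 1),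
      |((((Lc ^ m : ℕ) : ℝ)) ^ 8)⁻¹ * (toReal w μ * toReal w ν *
          baseKer (fineHessA (axDressK (Lc ^ m) (KPerf (d := 3) Lc (sfStep Lc) (smStep 3 Lc) m)) (coProj (Lc ^ m) S) Wf μ ν) b w)|
        ≤ Et / ((r : ℝ) + 1) ^ 4 * Real.exp (-(δ / Lr) * ((r : ℝ) + 1))) :
    |B12Beta.secondMoment (TPerfOf (Lc ^ m) (KPerf (d := 3) Lc (sfStep Lc) (smStep 3 Lc) m) S
          (vertex2OfK (KPerf (d := 3) Lc (sfStep Lc) (smStep 3 Lc) m) (Lc ^ m) Wf)) μ ν - 0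
        - ∑ b ∈ (univ : Finset (Fin 4 → Fin (Lc ^ m))).image resSite, ((((Lc ^ m : ℕ) : ℝ)) ^ 4)⁻¹ *
            ∑ w ∈ annulus 4 0 R₀, toReal w μ * toReal w ν * ∑ i ∈ s, cc₀ i * (F' b i w * G' b i w)|
      ≤ U₁ + 80 * Et * (1 + Lr / δ) :=
  hrep_perfect_of_rows hLc hm hS hδs hScov hW hδ2 hWcov hWsymm
    (hrow_perfect_of_letters hLc hm hM hE hR hS hδs hW hδ2 hWsymm hcH hXc hEXc hSd hX₂ hEX₂ hNr hN0 hWd) hT1 μ ν hMR hEt hδ hL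
    hlegs htail

end Perfect

end Summit.QuantumFields.BalabanUV.Beta.FP.PerfectFineWard

end
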